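import Summits.ValiantsHypothesis.ValiantsHypothesis.Theorems.GeneratorObstructionsPerGenDegreeSuperQPRectangularAtom
import Literature.Computability.AlgebraicComplexity.MultiplicityObstructionsProofs
import Literature.Computability.AlgebraicComplexity.CoordRepRational
import Literature.RepresentationTheory.GeneralLinear.RectangularHighestWeightSemiInvariant

/-!
# Route GeneratorObstructions — K1 `PerGenDegreeSuperQP` (stmt-ValiantsHypothesis-11654),
# line `per-side-atoms`: the first rectangular atom sits in degree `e(per_m)`;
# `stub_atomLate` ⇐ late fundamental invariants (Bürgisser–Ikenmeyer 2017)

Fourth support file of the line (companions `…AtomCertificates`, `…RectangularAtom`,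
`…AtomsGenerate`). It identifies the degree of the atom produced in `…RectangularAtom` with a
NAMED quantity of the literature — BI 2017's minimal degree `e(w) = minimalDegree` (Def. 3.3: the
least positive degree of a homogeneous `SL`-invariant polynomial function on `Sym^D` not vanishing
on the orbit of `w`) — and records the resulting conditional route to `stub_atomLate`.

1. `map_mk_highestWeightSpace_coordRep` / `exists_hwv_not_mem_of_occurs` (any `f`, any weight):
   `HWV_χ(ℂ[Sym^n]) ↠ HWV_χ(ℂ[Δ_n[f]])` (complete reducibility, BLMW §5.2), so an occurring weight
   is carried by a highest-weight vector of `ℂ[Sym^n]` outside `I(GL·f)`.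
2. (`Fin N` model) occurring CONSTANT weights `-k·𝟙` of `ℂ[Δ_D[p]]` ↔ positive degrees `d` of
   `E(p)` with `N k = D d` (`exists_mem_degreeMonoid_of_hasHighestWeight_const`,
   `hasHighestWeight_const_of_mem_degreeMonoid`; constant-weight vectors of a rational
   representation are `det`-semi-invariants, hence `SL`-invariant; an invariant outside the ideal
   does not vanish AT `p` along `GL·p = ℂ^× SL·p`).
3. For the permanent (`m ≥ 1`): `-k·𝟙` occurs in `ℂ[Δ_m[per_m]]` iff `m k ∈ E(per_m)`
   (`per_hasHighestWeight_const_iff_mem_degreeMonoid`), every positive degree of `E(per_m)` is a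
   multiple of `m`, and therefore **the least constant atom has degree exactly `e(per_m)`**
   (`per_exists_atom_degree_eq_minimalDegree`).
4. `stub_atomLate_of_minimalDegree_late` — **late fundamental invariants ⇒ late atoms**: if
   `e(per_m) > 2^((log₂ m + c)^c)` for infinitely many `m` (every `c`), the registered
   `stub_atomLate` holds VERBATIM. What is known about `e(per_m)`: `≥ m²` (BI 2017 §3.3, in tree:
   `sq_le_minimalDegree_per`); `= m²` iff `m` even and `P_{m,m²}(per_m) ≠ 0`, a signed count of
   admissible tables (BI 2017 Prop. 3.28; nonzero at `m = 2, 4`); for odd `m`, `e(per_m) > m²` with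
   no value or bound in print. The hypothesis is OPEN and plausibly FALSE along even `m`; along odd
   `m` it is a concrete invariant-theoretic question. This is a reduction, not progress on VP ≠ VNP.

References: [BurgisserIkenmeyer2017] Def. 3.3, Lemma 3.2, Rem. 3.13, §3.3, Prop. 3.28;
[BurgisserEtAl2011] §5.2.
-/

set_option linter.dupNamespace false

noncomputable section

namespace Summit.ValiantsHypothesis.ValiantsHypothesis.Theorems.GeneratorObstructions.PerGenDegreeSuperQP

open MvPolynomial
open Literature.NumberTheory.DiophantineGeometry Literature.Computability.AlgebraicComplexity
  Literature.Computability.Complexity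

/-! ### 1. Highest-weight vectors of `ℂ[Δ_n[f]]` lift to highest-weight vectors of `ℂ[Sym^n]`
outside the ideal -/

section Lift

variable {σ : Type*} [Fintype σ] [LinearOrder σ]

/-- **Highest-weight spaces map ONTO highest-weight spaces under `ℂ[Sym^n] ↠ ℂ[Δ_n[f]]`** (any
weight `χ`): the quotient map is a `GL`-equivariant surjection and `ℂ[Sym^n]` is completely
reducible (`isSemisimpleRepresentation_coordRep`), so highest-weight vectors lift
(`map_highestWeightSpace_eq_of_surjective`; BLMW 2011 §5.2). [cite: BurgisserEtAl2011, §5.2] -/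
theorem map_mk_highestWeightSpace_coordRep (f : MvPolynomial σ ℂ) (n : ℕ) (χ : Weight σ) :
    (highestWeightSpace (coordRep σ ℂ n) χ).map
        (Ideal.Quotient.mkₐ ℂ (orbitVanishingIdeal f n)).toLinearMap =
      highestWeightSpace (orbitCoordRep f n) χ := by
  let π : (coordRep σ ℂ n).IntertwiningMap (orbitCoordRep f n) :=
    { toLinearMap := (Ideal.Quotient.mkₐ ℂ (orbitVanishingIdeal f n)).toLinearMap
      isIntertwining' := fun A => by
        refine LinearMap.ext fun F => ?_
        simp only [LinearMap.coe_comp, Function.comp_apply, AlgHom.toLinearMap_apply,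
          Ideal.Quotient.mkₐ_eq_mk, orbitCoordRep_apply, orbitCoordSubst_mk, coordRep_apply] }
  have hπ : Function.Surjective π := by
    intro y
    obtain ⟨F, rfl⟩ := Ideal.Quotient.mk_surjective y
    exact ⟨F, rfl⟩
  exact map_highestWeightSpace_eq_of_surjective π hπ (isSemisimpleRepresentation_coordRep n) χ

/-- Hence an OCCURRING weight of `ℂ[Δ_n[f]]` is carried by a genuine highest-weight vector of
`ℂ[Sym^n]` lying OUTSIDE the vanishing ideal of the orbit. [cite: BurgisserEtAl2011, §5.2] -/
theorem exists_hwv_not_mem_of_occurs (f : MvPolynomial σ ℂ) (n : ℕ) {χ : Weight σ}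
    (h : highestWeightSpace (orbitCoordRep f n) χ ≠ ⊥) :
    ∃ F : MvPolynomial (DegIdx σ n) ℂ, F ∈ highestWeightSpace (coordRep σ ℂ n) χ ∧
      F ∉ orbitVanishingIdeal f n := by
  obtain ⟨v, hv, hv0⟩ := (Submodule.ne_bot_iff _).mp h
  rw [← map_mk_highestWeightSpace_coordRep f n χ] at hv
  obtain ⟨F, hF, rfl⟩ := Submodule.mem_map.mp hv
  refine ⟨F, hF, fun hI => hv0 ?_⟩
  rw [AlgHom.toLinearMap_apply, Ideal.Quotient.mkₐ_eq_mk]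
  exact Ideal.Quotient.eq_zero_iff_mem.mpr hI

end Lift

/-! ### 2. `Fin N` model: occurring constant weights ARE the positive part of BI 2017's degree
monoid `E(p)` -/

section FinModel

variable {N D : ℕ}

/-- **An occurring constant weight gives an element of the degree monoid.** If `-k·𝟙` (`k ≥ 1`)
occurs in `ℂ[Δ_D[p]]` (`D ≠ 0`, `p` on `Fin N`), then `N k = D d` for some `d ≥ 1` with
`d ∈ E(p)` (BI 2017 Def. 3.3): a highest-weight vector `F ∉ I(GL·p)` of constant weight is an
`SL_N`-invariant (`det`-semi-invariance of constant-weight vectors in a rational representation,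
tree `apply_eq_self_of_mem_highestWeightSpace_const_of_det_eq_one`) and homogeneous of the degree
pinned by the weight. [cite: BurgisserIkenmeyer2017, Def. 3.3 and Rem. 3.13] -/
theorem exists_mem_degreeMonoid_of_hasHighestWeight_const (hN : 0 < N) (hD : D ≠ 0)
    (p : MvPolynomial (Fin N) ℂ) {k : ℕ} (hk : 0 < k)
    (h : HasHighestWeight (orbitCoordRep p D) (fun _ : Fin N => -(k : ℤ))) :
    ∃ d : ℕ, N * k = D * d ∧ 0 < d ∧ d ∈ degreeMonoid D p := by
  haveI : Infinite ℂ := CharZero.infinite ℂ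
  obtain ⟨-, d, hd⟩ := nonpos_and_exists_size_eq_of_hasHighestWeight_orbitCoordRep p h
  have hsize : Weight.size (fun _ : Fin N => -(k : ℤ)) = -((N * k : ℕ) : ℤ) := by
    rw [Weight.size, Finset.sum_const, Finset.card_univ, Fintype.card_fin, nsmul_eq_mul]
    push_cast
    ring
  have hNk : N * k = D * d := by
    have := hsize.symm.trans hd
    exact_mod_cast neg_injective this
  obtain ⟨F, hF, hFI⟩ := exists_hwv_not_mem_of_occurs p D (show _ ≠ ⊥ from h)
  have hFh : F.IsHomogeneous d := isHomogeneous_of_mem_highestWeightSpace hD hF hd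
  have hFi : IsSLInvariantCoord D F := fun g =>
    apply_eq_self_of_mem_highestWeightSpace_const_of_det_eq_one (isRationalRep_coordRep D) hF
      (by rw [Matrix.SpecialLinearGroup.coe_GL_coe_matrix]; exact g.det_coe)
  refine ⟨d, hNk, ?_, F, hFh, hFi, hFI⟩
  rcases Nat.eq_zero_or_pos d with h0 | h0
  · exfalso
    rw [h0, mul_zero] at hNk
    exact Nat.mul_ne_zero hN.ne' hk.ne' hNk
  · exact h0

/-- **`GL_N(ℂ) = ℂ^× · SL_N(ℂ)`** (`N ≥ 1`): every invertible matrix is a nonzero scalar times a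
matrix of determinant one (an `N`-th root of the determinant). [cite: BurgisserIkenmeyer2017, Lemma 3.2 (1) (proof)] -/
theorem exists_smul_sl_coe_eq' (hN : 0 < N) (A : GL (Fin N) ℂ) :
    ∃ (s : ℂ) (h : Matrix.SpecialLinearGroup (Fin N) ℂ), s ≠ 0 ∧
      (A : Matrix (Fin N) (Fin N) ℂ) = s • (h : Matrix (Fin N) (Fin N) ℂ) := by
  obtain ⟨s, hs⟩ := IsAlgClosed.exists_pow_nat_eq (Matrix.det (A : Matrix (Fin N) (Fin N) ℂ)) hN
  have hs0 : s ≠ 0 := by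
    rintro rfl
    rw [zero_pow hN.ne'] at hs
    exact (Matrix.isUnits_det_units A).ne_zero hs.symm
  refine ⟨s, ⟨s⁻¹ • (A : Matrix (Fin N) (Fin N) ℂ), ?_⟩, hs0, ?_⟩
  · rw [Matrix.det_smul, ← hs, inv_pow, Fintype.card_fin, inv_mul_cancel₀ (pow_ne_zero _ hs0)]
  · change (A : Matrix (Fin N) (Fin N) ℂ) = s • (s⁻¹ • (A : Matrix (Fin N) (Fin N) ℂ))
    rw [smul_smul, mul_inv_cancel₀ hs0, one_smul]

/-- **An `SL_N`-invariant not in `I(GL · p)` does not vanish AT `p`** (`p` a form of degree `D`,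
`N ≥ 1`): along `GL · p = ℂ^× SL · p` the invariant only rescales, `F((s h) · p) = s^{Dd} F(p)`.
[cite: BurgisserIkenmeyer2017, Lemma 3.2 (1) (proof)] -/
theorem aeval_formCoeff_ne_zero_of_not_mem (hN : 0 < N) {p : MvPolynomial (Fin N) ℂ}
    (hp : p.IsHomogeneous D) {F : MvPolynomial (DegIdx (Fin N) D) ℂ} {d : ℕ}
    (hFd : F.IsHomogeneous d) (hFi : IsSLInvariantCoord D F) (hFI : F ∉ orbitVanishingIdeal p D) :
    aeval (formCoeff D p) F ≠ 0 := by
  intro h0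
  apply hFI
  rw [mem_orbitVanishingIdeal_iff]
  intro A
  obtain ⟨s, h, -, hA⟩ := exists_smul_sl_coe_eq' hN A
  rw [linSubstRep_apply, hA, linSubst_smul_of_isHomogeneous hp, formCoeff_smul,
    aeval_smul_pt_of_isHomogeneous' hFd, hFi.aeval_formCoeff_linSubst h p, h0, mul_zero]

/-- **An element of the degree monoid gives an occurring constant weight** (`N ≥ 1`, `p` a form of
degree `D`): for `d ∈ E(p)` the constant weight `-(Dd/N)·𝟙` occurs in `ℂ[Δ_D[p]]`, and `N ∣ D d`.
[cite: BurgisserIkenmeyer2017, Def. 3.3 and Rem. 3.13] -/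
theorem hasHighestWeight_const_of_mem_degreeMonoid (hN : 0 < N) {p : MvPolynomial (Fin N) ℂ}
    (hp : p.IsHomogeneous D) {d : ℕ} (hd : d ∈ degreeMonoid D p) :
    N ∣ D * d ∧ HasHighestWeight (orbitCoordRep p D) (fun _ : Fin N => -((D * d / N : ℕ) : ℤ)) := by
  obtain ⟨F, hFd, hFi, hFI⟩ := hd
  have hne := aeval_formCoeff_ne_zero_of_not_mem hN hp hFd hFi hFI
  exact ⟨dvd_mul_of_isSLInvariantCoord_of_aeval_ne_zero hN hp hFd hFi hne,
    hasHighestWeight_const_of_isSLInvariantCoord hN hp hFd hFi hne⟩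

end FinModel

/-! ### 3. The permanent: occurring constant weights `-k·𝟙` ↔ degrees `m k ∈ E(per_m)`; the least
constant atom sits in degree `e(per_m)` (BI 2017's minimal degree) -/

section Permanent

variable {m : ℕ}

/-- **Dictionary**: for `m ≥ 1` and `k ≥ 1`, the constant weight `-k·𝟙` occurs in
`ℂ[Δ_m[per_m]]` (lexicographic matrix variables) iff `m · k` lies in BI 2017's degree monoid
`E(per_m)` (`per_m` on `Fin m × Fin m`), i.e. iff some homogeneous `SL_{m²}`-invariant of degree
`m k` does not vanish at `per_m`. [cite: BurgisserIkenmeyer2017, Def. 3.3] -/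
theorem per_hasHighestWeight_const_iff_mem_degreeMonoid (hm : 1 ≤ m) {k : ℕ} (hk : 0 < k) :
    HasHighestWeight (orbitCoordRep (rename toLex (perPoly (Fin m) ℂ)) m) (fun _ : MatIdx m => -(k : ℤ)) ↔
      m * k ∈ degreeMonoid m (perPoly (Fin m) ℂ) := by
  classical
  haveI : Infinite ℂ := CharZero.infinite ℂ
  set e : Fin m × Fin m ≃ Fin (m * m) := finProdFinEquiv with he
  set p : MvPolynomial (Fin (m * m)) ℂ := rename e (perPoly (Fin m) ℂ) with hpdef
  have hp : p.IsHomogeneous m := by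
    simpa [Fintype.card_fin] using
      (perPoly_isHomogeneous (n := Fin m) (k := ℂ)).rename_isHomogeneous (f := e)
  have hN : 0 < m * m := Nat.mul_pos hm hm
  -- transport of occurrence between the two numberings of the variables
  set κ : Fin (m * m) → MatIdx m := fun i => toLex (e.symm i) with hκ
  have hκinj : Function.Injective κ := fun i j hij => e.symm.injective (toLex.injective hij)
  have key := hasHighestWeight_orbitCoordRep_rename_dualOfPartition_iff (k := ℂ) (m := m)
    (matIdxEquiv m) κ hκinj p (by omega) (Nat.Partition.rectangle (m * m) k)
    (Nat.Partition.card_parts_rectangle_le (m * m) k)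
  rw [dualOfPartition_rectangle_self, hκ, hpdef, he, rename_perFin_eq m] at key
  change HasHighestWeight (orbitCoordRep (rename toLex (perPoly (Fin m) ℂ)) m)
      (fun _ : MatIdx m => -(k : ℤ)) ↔
    HasHighestWeight (orbitCoordRep p m) (fun _ : Fin (m * m) => -(k : ℤ)) at key
  rw [key, ← degreeMonoid_rename_equiv e m (perPoly (Fin m) ℂ), ← hpdef]
  constructor
  · intro h
    obtain ⟨d, hNk, -, hdE⟩ := exists_mem_degreeMonoid_of_hasHighestWeight_const hN (by omega) p hk h
    have hd : d = m * k := by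
      have : m * (m * k) = m * d := by rw [← mul_assoc]; exact hNk
      exact (Nat.eq_of_mul_eq_mul_left hm this).symm
    rwa [hd] at hdE
  · intro hdE
    obtain ⟨-, h⟩ := hasHighestWeight_const_of_mem_degreeMonoid hN hp hdE
    have hq : m * (m * k) / (m * m) = k := by
      rw [← mul_assoc]
      exact Nat.mul_div_cancel_left k hN
    rwa [hq] at h

/-- **Every positive degree in `E(per_m)` is a multiple of `m`** (`m² ∣ m d`; BI 2017 Lemma 3.2(2)).
[cite: BurgisserIkenmeyer2017, Lemma 3.2 (2)] -/
theorem dvd_of_mem_degreeMonoid_per (hm : 1 ≤ m) {d : ℕ}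
    (hd : d ∈ degreeMonoid m (perPoly (Fin m) ℂ)) : m ∣ d := by
  classical
  haveI : Infinite ℂ := CharZero.infinite ℂ
  set e : Fin m × Fin m ≃ Fin (m * m) := finProdFinEquiv with he
  have hp : (rename e (perPoly (Fin m) ℂ)).IsHomogeneous m := by
    simpa [Fintype.card_fin] using
      (perPoly_isHomogeneous (n := Fin m) (k := ℂ)).rename_isHomogeneous (f := e)
  rw [← degreeMonoid_rename_equiv e m (perPoly (Fin m) ℂ)] at hd
  obtain ⟨hdvd, -⟩ := hasHighestWeight_const_of_mem_degreeMonoid (Nat.mul_pos hm hm) hp hd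
  obtain ⟨q, hq⟩ := hdvd
  refine ⟨q, Nat.eq_of_mul_eq_mul_left hm ?_⟩
  rw [← mul_assoc, ← hq]

/-- **The first rectangular atom sits in degree `e(per_m)`.** For `m ≥ 1` the occurrence monoid of
`ℂ[Δ_m[per_m]]` has an occurring ATOM `χ` (the least occurring constant weight, companion file
`per_exists_least_const_atom`) whose degree `-|χ|/m` is EXACTLY BI 2017's minimal degree
`e(per_m) = minimalDegree m per_m` — the least positive degree of an `SL_{m²}`-invariant not
vanishing at `per_m`. [cite: BurgisserIkenmeyer2017, Def. 3.3 and §3.3] -/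
theorem per_exists_atom_degree_eq_minimalDegree (hm : 1 ≤ m) :
    ∃ χ : Weight (MatIdx m),
      highestWeightSpace (orbitCoordRep (MvPolynomial.rename toLex (perPoly (Fin m) ℂ)) m) χ ≠ ⊥ ∧
      (∀ χ₁ χ₂ : Weight (MatIdx m), χ₁ + χ₂ = χ → χ₁ ≠ 0 → χ₂ ≠ 0 →
          highestWeightSpace (orbitCoordRep (MvPolynomial.rename toLex (perPoly (Fin m) ℂ)) m) χ₁ = ⊥ ∨
            highestWeightSpace (orbitCoordRep (MvPolynomial.rename toLex (perPoly (Fin m) ℂ)) m) χ₂ = ⊥) ∧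
      -(Weight.size χ) = (m : ℤ) * (minimalDegree m (perPoly (Fin m) ℂ) : ℕ) := by
  obtain ⟨k₀, hk₀, -, hocc, hmin, hatom⟩ := per_exists_least_const_atom hm
  refine ⟨fun _ => -(k₀ : ℤ), hocc, hatom, ?_⟩
  -- `e(per_m) = m k₀`
  have hmem : m * k₀ ∈ degreeMonoid m (perPoly (Fin m) ℂ) :=
    (per_hasHighestWeight_const_iff_mem_degreeMonoid hm hk₀).mp hocc
  have hpos : 0 < m * k₀ := Nat.mul_pos hm hk₀
  have hlow : ∀ d ∈ {d | d ∈ degreeMonoid m (perPoly (Fin m) ℂ) ∧ 0 < d}, m * k₀ ≤ d := by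
    rintro d ⟨hdE, hd0⟩
    obtain ⟨k, rfl⟩ := dvd_of_mem_degreeMonoid_per hm hdE
    have hk : 0 < k := Nat.pos_of_mul_pos_left hd0
    by_contra hlt
    rw [not_le] at hlt
    have hkk : k < k₀ := Nat.lt_of_mul_lt_mul_left hlt
    have hocck := (per_hasHighestWeight_const_iff_mem_degreeMonoid hm hk).mpr hdE
    exact hocck (hmin k hk hkk)
  have hmd : minimalDegree m (perPoly (Fin m) ℂ) = m * k₀ :=
    le_antisymm (Nat.sInf_le ⟨hmem, hpos⟩) (le_csInf ⟨m * k₀, hmem, hpos⟩ hlow)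
  rw [hmd, Weight.size, Finset.sum_const, Finset.card_univ, Fintype.card_lex, Fintype.card_prod,
    Fintype.card_fin, nsmul_eq_mul]
  push_cast
  ring

/-- **Late fundamental invariants ⇒ late atoms.** `stub_atomLate` FOLLOWS from super-quasi-polynomial
growth of BI 2017's minimal degree `e(per_m)` along a subsequence: if for every `c, m₀` some
`m ≥ max(m₀, 1)` has `2^((log₂ m + c)^c) < e(per_m)`, then the registered `stub_atomLate` holds
verbatim (the first rectangular atom is the witness). Known: `e(per_m) ≥ m²` (BI 2017 §3.3, in
tree), `= m²` iff `m` is even and `P_{m,m²}(per_m) ≠ 0` (a signed count of admissible tables,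
BI 2017 Prop. 3.28 — nonzero for `m = 2, 4`); for odd `m`, `e(per_m) > m²` and its size is not
known. The hypothesis is therefore OPEN (plausibly false along even `m`); this is a reduction, not
a proof. [cite: BurgisserIkenmeyer2017, §3.3 and Prop. 3.28] -/
theorem stub_atomLate_of_minimalDegree_late
    (H : ∀ c m₀ : ℕ, ∃ m : ℕ, m₀ ≤ m ∧ 1 ≤ m ∧
      2 ^ ((Nat.log 2 m + c) ^ c) < minimalDegree m (perPoly (Fin m) ℂ)) :
    ∀ c m₀ : ℕ, ∃ m : ℕ, m₀ ≤ m ∧ 1 ≤ m ∧ ∃ χ : Weight (MatIdx m),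
      highestWeightSpace (orbitCoordRep (MvPolynomial.rename toLex (perPoly (Fin m) ℂ)) m) χ ≠ ⊥ ∧
      (∀ χ₁ χ₂ : Weight (MatIdx m), χ₁ + χ₂ = χ → χ₁ ≠ 0 → χ₂ ≠ 0 →
          highestWeightSpace (orbitCoordRep (MvPolynomial.rename toLex (perPoly (Fin m) ℂ)) m) χ₁ = ⊥ ∨
            highestWeightSpace (orbitCoordRep (MvPolynomial.rename toLex (perPoly (Fin m) ℂ)) m) χ₂ = ⊥) ∧
      (m : ℤ) * 2 ^ ((Nat.log 2 m + c) ^ c) < -(Weight.size χ) := by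
  intro c m₀
  obtain ⟨m, hm₀, hm, hlt⟩ := H c m₀
  obtain ⟨χ, hocc, hatom, hdeg⟩ := per_exists_atom_degree_eq_minimalDegree hm
  refine ⟨m, hm₀, hm, χ, hocc, hatom, ?_⟩
  rw [hdeg]
  have hm0 : (0 : ℤ) < m := by exact_mod_cast hm
  exact mul_lt_mul_of_pos_left (by exact_mod_cast hlt) hm0

/-- Conversely on the rectangular direction nothing more is available: the first rectangular
atom has degree `≥ m²` unconditionally (BI 2017 §3.3 in tree: `m² ≤ e(per_m)` for `m ≥ 2`) —
recovering `per_exists_atom_sq_le_degree` of the companion file through `e(per_m)`.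
[cite: BurgisserIkenmeyer2017, §3.3 (before Rem. 3.27)] -/
theorem sq_le_minimalDegree_per (hm : 2 ≤ m) : m * m ≤ minimalDegree m (perPoly (Fin m) ℂ) :=
  ((BI2017_minimalDegree_det_per_holds.1 m hm).2).1

end Permanent



end Summit.ValiantsHypothesis.ValiantsHypothesis.Theorems.GeneratorObstructions.PerGenDegreeSuperQP

end
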